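import Mathlib
import Summits.ValiantsHypothesis.ValiantsHypothesis.Theorems.LacunarySymmetroidMatrixDescartesCensusRealExponentsTwoByTwoKit

/-!
# `MatrixDescartes` census — `2 × 2` pencils: the real-exponent transfer for EVERY bound (non-sharp rows included)

HONEST FRAMING.  Object-search cell `pub-symmetroid`, item `DoorA26 = PosRootLawAt 2 6 19`
(stmt-ValiantsHypothesis-19979; OPEN, typed, never asserted) and the cell's `V = 19` rows
(`PosRootLawOn 2 6 18 d`); this file proves an EQUIVALENCE about the `m = 2` rows and decides nothing.
Nothing here bears on `MatrixDescartes` (stmt-ValiantsHypothesis-18050) or `VP ≠ VNP`.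

`posRootLawAt_iff_rpow` (…Doors) needs a SHARP bound: there all zeros of a counterexample are simple.
For `2 × 2` symmetric pencils the sharpness hypothesis can be removed:

* `posRootLawAt_two_iff_rpow` — **for every `K` and every `B`:
  `PosRootLawAt 2 K B ↔ ∀ δ : Fin K → ℝ, ∀ S symmetric, #{x > 0 : det ∑_l x^{δ_l} S_l = 0} ≤ B`.**
  So every census register `ζ_sym(2,K)` (all levels, not only the Descartes-sharp one) is a statement
  about real exponent vectors; e.g. «a real symmetric (2,6) NINETEEN exists on some integer support» iff
  one exists on some real exponent vector.

PROOF (→; ← is `posRootLawAt_of_rpow`): sort the finitely many zeros `g_j` of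
`G = det ∑ e^{δ_l t} S_l`, put `ρ_j = g_j − η < g_j < λ_j = g_j + η` (`3η ≤` min gap); perturb ONE letter
`S₀ ↦ S₀ + εW`, `W = τ[[1,c],[c,c²+s]]` (`det(F+εW) = det F + ε⟨F,W⟩ + ε² det W`); choose `c` off the roots
of the quadratics `Q_j(c) = ⟨F(g_j), [[1,c],[c,c²+s]]⟩`, and the signs `s`, `τ` by MAJORITY, so that at
≥ half of the touching zeros `G_ε(g_j)` gets the sign opposite to `G(ρ_j)` while `G_ε` keeps the sign of
`G` at all `ρ_j, λ_j` and `G_ε(g_j) ≠ 0`; then `G_ε` has ≥ #crossing + 2·#good ≥ n ≥ B + 1 sign variations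
along `ρ₁ < g₁ < λ₁ < ρ₂ < ⋯`, contradicting `card_signVar_le`.

[folklore] Elementary perturbation and counting; Laguerre via the kit; IVT.
-/

-- `Summit.ValiantsHypothesis.ValiantsHypothesis.…` repeats a component by the D-0017 layout
-- (single-conjunct summit), which the `dupNamespace` linter flags; the name is mandated.
set_option linter.dupNamespace false

namespace Summit.ValiantsHypothesis.ValiantsHypothesis.Theorems.LacunarySymmetroidMatrixDescartes.Census.RealExp

open Finset Filter Topology Polynomial
open scoped BigOperators Matrix
open Summit.ValiantsHypothesis.ValiantsHypothesis.Theorems.MatrixDescartes.Negative (PosRootLawAt)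

section TwoByTwo

-- One long elementary proof (finite bookkeeping over the zeros); measured above the default budget.
set_option maxHeartbeats 800000 in
/-- **The `2 × 2` real-exponent transfer for EVERY bound.**  For all `K`, `B`:
`PosRootLawAt 2 K B` (every real symmetric `2 × 2` pencil with `K` lacunary terms on an INTEGER support
has `≤ B` distinct positive det-roots) iff the same holds for every REAL exponent vector
`δ : Fin K → ℝ` (zeros of `x ↦ det ∑_l x^{δ_l} S_l` on `(0,∞)`, `Set.ncard`).  No sharpness hypothesis:
touching zeros of a real-exponent counterexample are split into sign changes by a one-letter symmetric
perturbation before the exponents are made rational (module docstring). [folklore] -/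
theorem posRootLawAt_two_iff_rpow (K B : ℕ) :
    PosRootLawAt 2 K B ↔
      ∀ (δ : Fin K → ℝ) (S : Fin K → Matrix (Fin 2) (Fin 2) ℝ), (∀ l, (S l).IsSymm) →
        {x : ℝ | 0 < x ∧ (∑ l, (x ^ (δ l)) • S l).det = 0}.ncard ≤ B := by
  classical
  refine ⟨fun hlaw δ S hS => ?_, posRootLawAt_of_rpow⟩
  rcases K.eq_zero_or_pos with hK | hK
  · subst hK
    have : {x : ℝ | 0 < x ∧ (∑ l : Fin 0, (x ^ (δ l)) • S l).det = 0} = Set.Ioi 0 := by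
      ext x
      simp
    have hinf : (Set.Ioi (0 : ℝ)).Infinite := Set.Ioi_infinite 0
    rw [this, hinf.ncard]
    exact Nat.zero_le B
  obtain ⟨k, rfl⟩ : ∃ k, K = k + 1 := ⟨K - 1, by omega⟩
  by_contra hcon
  push Not at hcon
  rw [ncard_rpow_eq_ncard_exp δ S] at hcon
  set G : ℝ → ℝ := fun t => (∑ l, Real.exp (δ l * t) • S l).det with hG
  set Zt : Set ℝ := {t | G t = 0} with hZt
  change B < Zt.ncard at hcon
  set α : Equiv.Perm (Fin 2) × (Fin 2 → Fin (k + 1)) → ℝ :=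
    fun q => ((Equiv.Perm.sign q.1 : ℤ) : ℝ) * ∏ i, S (q.2 i) (q.1 i) i with hα
  set sx : Equiv.Perm (Fin 2) × (Fin 2 → Fin (k + 1)) → ℝ := fun q => ∑ i, δ (q.2 i) with hsx
  have hGsum : ∀ t, G t = ∑ q, α q * Real.exp (sx q * t) := fun t => det_expPencil_eq_expSum δ S t
  have hfin : Zt.Finite := by
    rcases expSum_zero_or_ncard_le α sx with h | h
    · exfalso
      have huniv : Zt = Set.univ := Set.eq_univ_iff_forall.mpr fun t => by
        rw [hZt, Set.mem_setOf_eq, hGsum]; exact h t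
      rw [huniv, Set.infinite_univ.ncard] at hcon
      exact Nat.not_lt_zero B hcon
    · have : Zt = {t | ∑ q, α q * Real.exp (sx q * t) = 0} := by
        ext t; rw [hZt, Set.mem_setOf_eq, Set.mem_setOf_eq, hGsum]
      rw [this]; exact h.1
  obtain ⟨Zf, hZfmem⟩ : ∃ Zf : Finset ℝ, ∀ x, x ∈ Zf ↔ x ∈ Zt :=
    ⟨hfin.toFinset, fun x => hfin.mem_toFinset⟩
  have hZfeq : (↑Zf : Set ℝ) = Zt := Set.ext fun x => hZfmem x
  set n : ℕ := Zf.card with hn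
  have hnB : B + 1 ≤ n := by rw [hn, ← Set.ncard_coe_finset, hZfeq]; exact hcon
  have hn0 : 0 < n := by omega
  set g := Zf.orderEmbOfFin rfl with hg
  have hgmono : StrictMono g := (Zf.orderEmbOfFin rfl).strictMono
  have hgzero : ∀ j, G (g j) = 0 := fun j => (hZfmem _).mp (Finset.orderEmbOfFin_mem Zf rfl j)
  have hall : ∀ t, G t = 0 → ∃ j, g j = t := by
    intro t ht
    have h1 : t ∈ Zf := (hZfmem t).mpr ht
    have h2 : t ∈ Set.range g := by rw [hg, Finset.range_orderEmbOfFin]; exact h1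
    exact h2
  obtain ⟨η, hη, hgap⟩ := exists_third_gap g hgmono
  have hnotzero : ∀ (j : Fin n) (u : ℝ), u = g j - η ∨ u = g j + η → G u ≠ 0 := by
    intro j u hu hGu
    obtain ⟨i, hi⟩ := hall u hGu
    rcases lt_trichotomy i j with hij | rfl | hij
    · have := hgap i j hij; rcases hu with rfl | rfl <;> linarith
    · rcases hu with h | h <;> linarith
    · have := hgap j i hij; rcases hu with rfl | rfl <;> linarith
  have hρ : ∀ j, G (g j - η) ≠ 0 := fun j => hnotzero j _ (Or.inl rfl)
  have hlam : ∀ j, G (g j + η) ≠ 0 := fun j => hnotzero j _ (Or.inr rfl)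
  set F : ℝ → Matrix (Fin 2) (Fin 2) ℝ := fun t => ∑ l, Real.exp (δ l * t) • S l with hF
  have hFsymm : ∀ t, F t 1 0 = F t 0 1 := by
    intro t
    simp only [hF, Matrix.sum_apply, Matrix.smul_apply, smul_eq_mul]
    refine Finset.sum_congr rfl fun l _ => ?_
    rw [(hS l).apply 1 0]
  set R0 : Finset (Fin n) := univ.filter (fun j => F (g j) 0 0 = 0 ∧ F (g j) 0 1 = 0 ∧ F (g j) 1 1 = 0)
    with hR0
  set T : Finset (Fin n) := univ.filter (fun j => 0 < G (g j - η) * G (g j + η)) with hT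
  set Cr : Finset (Fin n) := univ.filter (fun j => ¬ 0 < G (g j - η) * G (g j + η)) with hCr
  have hTC : T.card + Cr.card = n := by
    have h := Finset.card_filter_add_card_filter_not (s := (univ : Finset (Fin n)))
      (fun j => 0 < G (g j - η) * G (g j + η))
    rw [Finset.card_univ, Fintype.card_fin] at h
    rw [hT, hCr]; exact h
  have hCr_neg : ∀ j ∈ Cr, G (g j - η) * G (g j + η) < 0 := by
    intro j hj
    rw [hCr, Finset.mem_filter] at hj
    rcases lt_trichotomy (G (g j - η) * G (g j + η)) 0 with h | h | h
    · exact h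
    · exact absurd h (mul_ne_zero (hρ j) (hlam j))
    · exact absurd h hj.2
  set T0 : Finset (Fin n) := T.filter (fun j => j ∈ R0) with hT0
  obtain ⟨s, hs1, hGood0_card⟩ := exists_sign_majority T0 (fun j => G (g j - η)) (fun j _ => hρ j)
  have hs_sq : s * s = 1 := by rcases hs1 with h | h <;> rw [h] <;> norm_num
  have hs0 : s ≠ 0 := by rcases hs1 with h | h <;> rw [h] <;> norm_num
  set Good0 : Finset (Fin n) := T0.filter (fun j => s * G (g j - η) < 0) with hGood0
  have hGood0_card' : T0.card ≤ 2 * Good0.card := by simpa only using hGood0_card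
  set Qp : Fin n → ℝ[X] := fun j => C (F (g j) 0 0) * X ^ 2 + C (-2 * F (g j) 0 1) * X +
    C (F (g j) 0 0 * s + F (g j) 1 1) with hQp
  have hQp_ne : ∀ j, j ∉ R0 → Qp j ≠ 0 := by
    intro j hj hzero
    apply hj
    obtain ⟨h2, h1, h0⟩ := quadratic_eq_zero hzero
    rw [hR0, Finset.mem_filter]
    refine ⟨mem_univ _, h2, by linarith, ?_⟩
    rw [h2, zero_mul, zero_add] at h0; exact h0
  obtain ⟨c, hQc'⟩ := exists_eval_ne_zero (univ.filter (fun j => j ∉ R0)) Qp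
    (fun j hj => hQp_ne j (by rw [Finset.mem_filter] at hj; exact hj.2))
  have hQc : ∀ j, j ∉ R0 → (Qp j).eval c ≠ 0 :=
    fun j hj => hQc' j (by rw [Finset.mem_filter]; exact ⟨mem_univ _, hj⟩)
  have hQeval : ∀ j, (Qp j).eval c = F (g j) 0 0 * (c ^ 2 + s) + F (g j) 1 1 - 2 * F (g j) 0 1 * c := by
    intro j; simp only [hQp, eval_add, eval_mul, eval_C, eval_pow, eval_X]; ring
  have hQzero : ∀ j, j ∈ R0 → (Qp j).eval c = 0 := by
    intro j hj
    rw [hR0, Finset.mem_filter] at hj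
    rw [hQeval, hj.2.1, hj.2.2.1, hj.2.2.2]; ring
  set T1 : Finset (Fin n) := T.filter (fun j => j ∉ R0) with hT1
  obtain ⟨τ, hτ1, hGood1_card⟩ := exists_sign_majority T1 (fun j => (Qp j).eval c * G (g j - η))
    (fun j hj => mul_ne_zero (hQc j (by rw [hT1, Finset.mem_filter] at hj; exact hj.2)) (hρ j))
  have hτ_sq : τ * τ = 1 := by rcases hτ1 with h | h <;> rw [h] <;> norm_num
  have hτ0 : τ ≠ 0 := by rcases hτ1 with h | h <;> rw [h] <;> norm_num
  set Good1 : Finset (Fin n) := T1.filter (fun j => τ * ((Qp j).eval c * G (g j - η)) < 0) with hGood1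
  have hGood1_card' : T1.card ≤ 2 * Good1.card := by simpa only using hGood1_card
  -- the perturbation matrix
  set W : Matrix (Fin 2) (Fin 2) ℝ := τ • !![1, c; c, c ^ 2 + s] with hW
  have hWsymm : W.IsSymm := (isSymm_pertMatrix c s).smul τ
  have hWdet : W.det = s := by
    rw [hW, Matrix.det_smul, det_pertMatrix, Fintype.card_fin]; rw [pow_two, hτ_sq, one_mul]
  have hW00 : W 0 0 = τ := by simp [hW]
  have hW11 : W 1 1 = τ * (c ^ 2 + s) := by simp [hW]
  have hW01 : W 0 1 = τ * c := by simp [hW]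
  have hW10 : W 1 0 = τ * c := by simp [hW]
  -- the perturbed determinant as an explicit function of `ε`
  set q : ℝ → ℝ := fun t => F t 0 0 * W 1 1 + F t 1 1 * W 0 0 - F t 0 1 * W 1 0 - F t 1 0 * W 0 1 with hq
  set Gp : ℝ → ℝ → ℝ := fun ε t => G t + (ε * Real.exp (δ 0 * t)) * q t +
    (ε * Real.exp (δ 0 * t)) ^ 2 * s with hGp
  have hGp_det : ∀ ε t, (∑ l, Real.exp (δ l * t) • Function.update S 0 (S 0 + ε • W) l).det = Gp ε t := by
    intro ε t
    rw [expPencil_update_zero, det_add_smul_fin_two, hWdet]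
  have hq_zero : ∀ j, q (g j) = τ * (Qp j).eval c := by
    intro j
    rw [hq]; simp only []
    rw [hW00, hW11, hW01, hW10, hFsymm, hQeval]; ring
  have hGp_cont : ∀ t, Continuous (fun ε => Gp ε t) := by
    intro t; rw [hGp]; simp only []; fun_prop
  -- the conditions on `ε`, each eventually true as `ε → 0⁺`
  have hev_keep : ∀ u : ℝ, G u ≠ 0 → ∀ᶠ ε in 𝓝[>] (0 : ℝ), 0 < Gp ε u * G u := by
    intro u hu
    have h0 : Gp 0 u * G u = G u * G u := by rw [hGp]; simp
    have hpos : 0 < G u * G u := mul_self_pos.mpr hu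
    have hcont : ContinuousAt (fun ε => Gp ε u * G u) 0 := ((hGp_cont u).mul continuous_const).continuousAt
    have h1 : ∀ᶠ ε in 𝓝 (0 : ℝ), 0 < Gp ε u * G u := by
      have := hcont.eventually (lt_mem_nhds (show 0 < Gp 0 u * G u by rw [h0]; exact hpos))
      exact this
    exact h1.filter_mono nhdsWithin_le_nhds
  have hev_good1 : ∀ j ∈ Good1, ∀ᶠ ε in 𝓝[>] (0 : ℝ), Gp ε (g j) * G (g j - η) < 0 := by
    intro j hj
    rw [hGood1, Finset.mem_filter] at hj
    set E := Real.exp (δ 0 * g j) with hE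
    have hEpos : 0 < E := Real.exp_pos _
    -- `Gp ε (g j) = ε E (q + ε E s)`; the bracket tends to `q(g j) G(ρ_j) < 0`
    have hform : ∀ ε, Gp ε (g j) * G (g j - η) = (ε * E) * ((q (g j) + ε * E * s) * G (g j - η)) := by
      intro ε; rw [hGp]; simp only []; rw [hgzero j]; ring
    have hlim0 : (q (g j) + 0 * E * s) * G (g j - η) < 0 := by
      rw [zero_mul, zero_mul, add_zero, hq_zero, mul_assoc]
      exact hj.2
    have hcont : Continuous (fun ε : ℝ => (q (g j) + ε * E * s) * G (g j - η)) := by fun_prop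
    have h1 : ∀ᶠ ε in 𝓝 (0 : ℝ), (q (g j) + ε * E * s) * G (g j - η) < 0 :=
      hcont.continuousAt.eventually (gt_mem_nhds hlim0)
    have h2 : ∀ᶠ ε in 𝓝[>] (0 : ℝ), 0 < ε := eventually_mem_nhdsWithin
    filter_upwards [h1.filter_mono nhdsWithin_le_nhds, h2] with ε hε1 hε2
    rw [hform]
    exact mul_neg_of_pos_of_neg (mul_pos hε2 hEpos) hε1
  have hev_good0 : ∀ j ∈ Good0, ∀ᶠ ε in 𝓝[>] (0 : ℝ), Gp ε (g j) * G (g j - η) < 0 := by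
    intro j hj
    rw [hGood0, Finset.mem_filter] at hj
    have hj0 : j ∈ R0 := by have := hj.1; rw [hT0, Finset.mem_filter] at this; exact this.2
    have hq0 : q (g j) = 0 := by rw [hq_zero, hQzero j hj0, mul_zero]
    have h2 : ∀ᶠ ε in 𝓝[>] (0 : ℝ), 0 < ε := eventually_mem_nhdsWithin
    filter_upwards [h2] with ε hε
    have hform : Gp ε (g j) * G (g j - η) = (ε * Real.exp (δ 0 * g j)) ^ 2 * (s * G (g j - η)) := by
      rw [hGp]; simp only []; rw [hgzero j, hq0]; ring
    rw [hform]
    exact mul_neg_of_pos_of_neg (by positivity) hj.2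
  have hev_ne : ∀ j : Fin n, ∀ᶠ ε in 𝓝[>] (0 : ℝ), Gp ε (g j) ≠ 0 := by
    intro j
    set E := Real.exp (δ 0 * g j) with hE
    have hEpos : 0 < E := Real.exp_pos _
    have hform : ∀ ε, Gp ε (g j) = (ε * E) * (q (g j) + ε * E * s) := by
      intro ε; rw [hGp]; simp only []; rw [hgzero j]; ring
    have h2 : ∀ᶠ ε in 𝓝[>] (0 : ℝ), 0 < ε := eventually_mem_nhdsWithin
    by_cases hq0 : q (g j) = 0
    · filter_upwards [h2] with ε hε
      rw [hform, hq0, zero_add]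
      exact mul_ne_zero (mul_pos hε hEpos).ne' (mul_ne_zero (mul_pos hε hEpos).ne' hs0)
    · have hcont : Continuous (fun ε : ℝ => q (g j) + ε * E * s) := by fun_prop
      have h1 : ∀ᶠ ε in 𝓝 (0 : ℝ), q (g j) + ε * E * s ≠ 0 := by
        have h0' : (fun ε : ℝ => q (g j) + ε * E * s) 0 ≠ 0 := by simpa using hq0
        exact hcont.continuousAt.eventually_ne h0' 
      filter_upwards [h1.filter_mono nhdsWithin_le_nhds, h2] with ε hε1 hε2
      rw [hform]
      exact mul_ne_zero (mul_pos hε2 hEpos).ne' hε1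
  -- pick `ε`
  have hev_all : ∀ᶠ ε in 𝓝[>] (0 : ℝ), (∀ j : Fin n, 0 < Gp ε (g j - η) * G (g j - η)) ∧
      (∀ j : Fin n, 0 < Gp ε (g j + η) * G (g j + η)) ∧
      (∀ j : Fin n, j ∈ Good1 → Gp ε (g j) * G (g j - η) < 0) ∧
      (∀ j : Fin n, j ∈ Good0 → Gp ε (g j) * G (g j - η) < 0) ∧
      (∀ j : Fin n, Gp ε (g j) ≠ 0) := by
    refine (eventually_all.mpr fun j => hev_keep _ (hρ j)).and ((eventually_all.mpr fun j =>
      hev_keep _ (hlam j)).and ((eventually_all.mpr fun j => ?_).and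
      ((eventually_all.mpr fun j => ?_).and (eventually_all.mpr fun j => hev_ne j))))
    · by_cases hj : j ∈ Good1
      · exact (hev_good1 j hj).mono fun ε h _ => h
      · exact Eventually.of_forall fun ε h => absurd h hj
    · by_cases hj : j ∈ Good0
      · exact (hev_good0 j hj).mono fun ε h _ => h
      · exact Eventually.of_forall fun ε h => absurd h hj
  obtain ⟨ε, hkeepρ, hkeepl, hgood1, hgood0, hne⟩ := hev_all.exists
  -- the perturbed (symmetric) pencil and its sign variations along `ρ₁ < g₁ < λ₁ < ρ₂ < ⋯`
  set S' : Fin (k + 1) → Matrix (Fin 2) (Fin 2) ℝ := Function.update S 0 (S 0 + ε • W) with hS'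
  have hS'symm : ∀ l, (S' l).IsSymm := isSymm_update_zero S hS W hWsymm ε
  have hG' : ∀ t, (∑ l, Real.exp (δ l * t) • S' l).det = Gp ε t := hGp_det ε
  -- the point sequence
  obtain ⟨Pt, hPtmono, hPt⟩ := exists_pointSeq hn0 g hgmono hη hgap
  set M : ℕ := 3 * n with hM
  set p : Fin (M + 1) → ℝ := fun i => Pt i with hp
  have hpmono : StrictMono p := fun i j hij => hPtmono (Fin.lt_def.mp hij)
  -- the bound from the integer row
  have hbound := card_signVar_le hlaw δ S' hS'symm p hpmono
  simp only [hG'] at hbound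
  -- block indices
  have hb0lt : ∀ j : Fin n, 3 * (j : ℕ) < M := fun j => by omega
  have hb1lt : ∀ j : Fin n, 3 * (j : ℕ) + 1 < M := fun j => by omega
  set b0 : Fin n → Fin M := fun j => ⟨3 * j, hb0lt j⟩ with hb0
  set b1 : Fin n → Fin M := fun j => ⟨3 * j + 1, hb1lt j⟩ with hb1
  have hp_b0c : ∀ j, p (b0 j).castSucc = g j - η := fun j => by
    simp only [hp, hb0, Fin.val_castSucc]; exact (hPt j).1
  have hp_b0s : ∀ j, p (b0 j).succ = g j := fun j => by
    simp only [hp, hb0, Fin.val_succ]; exact (hPt j).2.1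
  have hp_b1c : ∀ j, p (b1 j).castSucc = g j := fun j => by
    simp only [hp, hb1, Fin.val_castSucc]; exact (hPt j).2.1
  have hp_b1s : ∀ j, p (b1 j).succ = g j + η := fun j => by
    simp only [hp, hb1, Fin.val_succ]; rw [show 3 * (j : ℕ) + 1 + 1 = 3 * (j : ℕ) + 2 by ring]
    exact (hPt j).2.2
  set I : Finset (Fin M) := univ.filter (fun i : Fin M => Gp ε (p i.castSucc) * Gp ε (p i.succ) < 0) with hI
  change I.card ≤ B at hbound
  -- membership of the three families
  set Good : Finset (Fin n) := Good0 ∪ Good1 with hGood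
  have hGoodT : ∀ j ∈ Good, j ∈ T := by
    intro j hj
    rw [hGood, Finset.mem_union] at hj
    rcases hj with h | h
    · rw [hGood0, Finset.mem_filter, hT0, Finset.mem_filter] at h; exact h.1.1
    · rw [hGood1, Finset.mem_filter, hT1, Finset.mem_filter] at h; exact h.1.1
  have hGood_sign : ∀ j ∈ Good, Gp ε (g j) * G (g j - η) < 0 := by
    intro j hj
    rw [hGood, Finset.mem_union] at hj
    rcases hj with h | h
    · exact hgood0 j h
    · exact hgood1 j h
  have hmem0 : ∀ j ∈ Good, b0 j ∈ I := by
    intro j hj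
    rw [hI, Finset.mem_filter, hp_b0c, hp_b0s]
    refine ⟨mem_univ _, ?_⟩
    -- signs: Gp(ρ) ~ G(ρ), Gp(g) ~ -G(ρ)
    exact mul_neg_of_keep_of_flip (hkeepρ j) (hGood_sign j hj)
  have hmem1 : ∀ j ∈ Good, b1 j ∈ I := by
    intro j hj
    rw [hI, Finset.mem_filter, hp_b1c, hp_b1s]
    refine ⟨mem_univ _, ?_⟩
    have hTj : 0 < G (g j - η) * G (g j + η) := by
      have := hGoodT j hj; rw [hT, Finset.mem_filter] at this; exact this.2
    exact mul_neg_of_keep_of_flip' (hkeepl j) (hGood_sign j hj) hTj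
  set χ : Fin n → Fin M := fun j => if Gp ε (g j - η) * Gp ε (g j) < 0 then b0 j else b1 j with hχ
  have hmemχ : ∀ j ∈ Cr, χ j ∈ I := by
    intro j hj
    have hneg := hCr_neg j hj
    have h1 := hkeepρ j
    have h3 := hkeepl j
    have hgj := hne j
    by_cases hcase : Gp ε (g j - η) * Gp ε (g j) < 0
    · have : χ j = b0 j := by rw [hχ]; simp only [hcase, if_true]
      rw [this, hI, Finset.mem_filter, hp_b0c, hp_b0s]
      exact ⟨mem_univ _, hcase⟩
    · have : χ j = b1 j := by rw [hχ]; simp only [hcase, if_false]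
      rw [this, hI, Finset.mem_filter, hp_b1c, hp_b1s]
      refine ⟨mem_univ _, ?_⟩
      push Not at hcase
      exact mul_neg_of_not_first (mul_neg_of_keep_keep h1 h3 hneg) hgj hcase
  -- counting
  have hinj0 : Function.Injective b0 := fun i j h => by
    have := congrArg Fin.val h; simp only [hb0] at this; exact Fin.ext (by omega)
  have hinj1 : Function.Injective b1 := fun i j h => by
    have := congrArg Fin.val h; simp only [hb1] at this; exact Fin.ext (by omega)
  have hχval : ∀ j, (χ j : ℕ) = 3 * j ∨ (χ j : ℕ) = 3 * j + 1 := by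
    intro j; rw [hχ]; simp only []; split_ifs <;> simp [hb0, hb1]
  have hinjχ : Set.InjOn χ ↑Cr := fun i _ j _ h => by
    have := congrArg Fin.val h
    rcases hχval i with hi | hi <;> rcases hχval j with hj' | hj' <;> rw [hi, hj'] at this <;>
      exact Fin.ext (by omega)
  have hsub : Good.image b0 ∪ Good.image b1 ∪ Cr.image χ ⊆ I := by
    intro x hx
    rw [Finset.mem_union, Finset.mem_union, Finset.mem_image, Finset.mem_image, Finset.mem_image] at hx
    rcases hx with (⟨j, hj, rfl⟩ | ⟨j, hj, rfl⟩) | ⟨j, hj, rfl⟩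
    · exact hmem0 j hj
    · exact hmem1 j hj
    · exact hmemχ j hj
  have hGoodCr : ∀ j ∈ Good, j ∉ Cr := by
    intro j hj hjC
    have h1 := hGoodT j hj
    rw [hT, Finset.mem_filter] at h1
    rw [hCr, Finset.mem_filter] at hjC
    exact hjC.2 h1.2
  have hdisj01 : Disjoint (Good.image b0) (Good.image b1) := by
    rw [Finset.disjoint_left]
    rintro x hx0 hx1
    rw [Finset.mem_image] at hx0 hx1
    obtain ⟨i, -, rfl⟩ := hx0
    obtain ⟨j, -, hj⟩ := hx1
    have := congrArg Fin.val hj; simp only [hb0, hb1] at this; omega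
  have hdisj2 : Disjoint (Good.image b0 ∪ Good.image b1) (Cr.image χ) := by
    rw [Finset.disjoint_left]
    rintro x hx hxC
    rw [Finset.mem_image] at hxC
    obtain ⟨j, hjC, rfl⟩ := hxC
    rw [Finset.mem_union, Finset.mem_image, Finset.mem_image] at hx
    rcases hx with ⟨i, hi, hij⟩ | ⟨i, hi, hij⟩
    · have hv := congrArg Fin.val hij; simp only [hb0] at hv
      have : i = j := by rcases hχval j with h | h <;> rw [h] at hv <;> exact Fin.ext (by omega)
      exact hGoodCr i hi (this ▸ hjC)
    · have hv := congrArg Fin.val hij; simp only [hb1] at hv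
      have : i = j := by rcases hχval j with h | h <;> rw [h] at hv <;> exact Fin.ext (by omega)
      exact hGoodCr i hi (this ▸ hjC)
  have hcardI : 2 * Good.card + Cr.card ≤ I.card := by
    have h1 := Finset.card_le_card hsub
    rw [Finset.card_union_of_disjoint hdisj2, Finset.card_union_of_disjoint hdisj01,
      Finset.card_image_of_injective _ hinj0, Finset.card_image_of_injective _ hinj1,
      Finset.card_image_of_injOn hinjχ] at h1
    omega
  -- `2·#Good ≥ #T`
  have hGood_card : T.card ≤ 2 * Good.card := by
    have hTsplit : T0.card + T1.card = T.card := by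
      rw [hT0, hT1]; exact Finset.card_filter_add_card_filter_not _
    have hdisjG : Disjoint Good0 Good1 := by
      rw [Finset.disjoint_left]
      intro j h0 h1
      rw [hGood0, Finset.mem_filter, hT0, Finset.mem_filter] at h0
      rw [hGood1, Finset.mem_filter, hT1, Finset.mem_filter] at h1
      exact h1.1.2 h0.1.2
    rw [hGood, Finset.card_union_of_disjoint hdisjG]
    omega
  omega

end TwoByTwo

end Summit.ValiantsHypothesis.ValiantsHypothesis.Theorems.LacunarySymmetroidMatrixDescartes.Census.RealExp
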